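import Literature.NumberTheory.LFunctions.WeilExplicitArchTermProofs
import Mathlib.Analysis.Calculus.DSlope
import Mathlib.MeasureTheory.Integral.IntegralEqImproper
import HarnessLib

/-!
# Motivic door — the archimedean Weil term is half a logarithmic-Laplacian energy

(pub-rhdoor, seat extrem-1.)  HONEST FRAMING (verbatim): lottery ticket at the motivic door; RH
probability negligible; consolation prizes are real: a new semi-local Weil-positivity theorem, or
a located gap in the Connes–Consani programme, plus the ff-door theorem.

PROVED here (standard axioms), for every Weil test function `F`, `k = weilSymm F`:
`weilArchTermBombieri F = ½ 𝓔(F) - log(2π) F(0) + ½ ∫₀^∞ k_r(x) k(x) dx`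
(`weilArchTermBombieri_eq_logLaplacian`), where
`𝓔(F) = ∫₀¹ (k(0) - k(x)) dx/x - ∫₁^∞ k(x) dx/x - γ k(0)` (`logLaplacianEnergy`) and
`k_r(x) = 1/x - e^{x/2}/sinh x` (`archResidualKernel`) is BOUNDED (`|k_r| ≤ 5` is proved; that
`k_r → -½` at `0⁺` is not needed).  Proof: split Bombieri's weight `e^{x/2}/sinh x = 1/x - k_r(x)` in
`weilArchTermBombieri` (= `weilArchTerm`, by `weilArchTermBombieri_eq_weilArchTerm_holds`) and
evaluate `∫₀¹ (1/sinh x - 1/x) dx + ∫₁^∞ dx/sinh x = log 2`.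

DERIVED, not formalised (why it matters): for real `g` supported in a window and `F = g ⋆ g̃`,
`𝓔(F) = ⟨g, L_Δ g⟩` is the quadratic form of the one-dimensional LOGARITHMIC LAPLACIAN
`L_Δ = (d/ds)(-Δ)^s|_{s=0}` (symbol `2 log|ξ|`; Chen–Weth, Comm. PDE 44 (2019), arXiv:1710.03416,
Thm 1.1, `N = 1`), so Weil's form on a window is `½ L_Δ - log 2π` plus bounded terms: the
operator-class fact behind the cell's EXTREMISERS.md §3.8.  Nothing here is a statement about
`ζ`; no number in this file is DATA.
-/

noncomputable section

set_option linter.dupNamespace false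

open Complex Filter Set MeasureTheory
open scoped Real Topology

namespace Summit.RiemannHypothesis.RiemannHypothesis.Theorems.MotivicDoor.ArchLogLaplacian

open Literature.NumberTheory.LFunctions

/-- The residual archimedean kernel `k_r(x) = 1/x - e^{x/2}/sinh x`: Bombieri's weight with its
singular part `1/x` removed (it extends continuously to `0`; only boundedness is proved here). -/
def archResidualKernel (x : ℝ) : ℝ := 1 / x - Real.exp (x / 2) / Real.sinh x

/-- The logarithmic-Laplacian energy of a test function, in the variable `k = weilSymm F`:
`𝓔(F) = ∫₀¹ (k(0) - k(x)) dx/x - ∫₁^∞ k(x) dx/x - γ k(0)`. -/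
def logLaplacianEnergy (F : ℝ → ℂ) : ℂ :=
  (∫ x in Ioc (0 : ℝ) 1, (weilSymm F 0 - weilSymm F x) / (x : ℂ)) -
    (∫ x in Ioi (1 : ℝ), weilSymm F x / (x : ℂ)) -
    (Real.eulerMascheroniConstant : ℂ) * weilSymm F 0

/-- **The residual kernel is bounded**: `|k_r(x)| ≤ 5` for `x > 0` (near `0`:
`|sinh x - x e^{x/2}| ≤ 2x² ≤ 2 x sinh x`; for `x > 1`: `0 < e^{x/2}/sinh x ≤ 4`). -/
theorem abs_archResidualKernel_le {x : ℝ} (hx : 0 < x) : |archResidualKernel x| ≤ 5 := by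
  have hs : 0 < Real.sinh x := Real.sinh_pos_iff.2 hx
  have hxs : x ≤ Real.sinh x := Real.self_le_sinh_iff.2 hx.le
  rcases le_or_gt x 1 with hx1 | hx1
  · have hk : archResidualKernel x = (Real.sinh x - x * Real.exp (x / 2)) / (x * Real.sinh x) := by
      unfold archResidualKernel
      field_simp
    set r1 : ℝ := Real.exp x - 1 - x with hr1
    set r2 : ℝ := Real.exp (-x) - 1 - (-x) with hr2
    set r3 : ℝ := Real.exp (x / 2) - 1 - x / 2 with hr3
    have b1 : |r1| ≤ x ^ 2 := Real.abs_exp_sub_one_sub_id_le (by rw [abs_of_pos hx]; exact hx1)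
    have b2 : |r2| ≤ (-x) ^ 2 :=
      Real.abs_exp_sub_one_sub_id_le (by rw [abs_neg, abs_of_pos hx]; exact hx1)
    have b3 : |r3| ≤ (x / 2) ^ 2 :=
      Real.abs_exp_sub_one_sub_id_le (by rw [abs_of_pos (by positivity)]; linarith)
    have hN : Real.sinh x - x * Real.exp (x / 2) = (r1 - r2) / 2 - x ^ 2 / 2 - x * r3 := by
      rw [Real.sinh_eq, hr1, hr2, hr3]; ring
    rw [neg_sq] at b2
    obtain ⟨⟨b1l, b1u⟩, ⟨b2l, b2u⟩, ⟨b3l, b3u⟩⟩ :=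
      And.intro (abs_le.1 b1) (And.intro (abs_le.1 b2) (abs_le.1 b3))
    have hx3 : x * (x / 2) ^ 2 ≤ x ^ 2 := by nlinarith
    have hNle : |Real.sinh x - x * Real.exp (x / 2)| ≤ 2 * x ^ 2 := by
      rw [hN, abs_le]
      constructor <;> nlinarith [mul_le_mul_of_nonneg_left b3u hx.le,
        mul_le_mul_of_nonneg_left b3l hx.le]
    rw [hk, abs_div, abs_of_pos (by positivity : 0 < x * Real.sinh x),
      div_le_iff₀ (by positivity)]
    calc |Real.sinh x - x * Real.exp (x / 2)| ≤ 2 * x ^ 2 := hNle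
      _ = 2 * (x * x) := by ring
      _ ≤ 2 * (x * Real.sinh x) := by gcongr
      _ ≤ 5 * (x * Real.sinh x) := by nlinarith
  · have hy : Real.exp x = Real.exp (x / 2) ^ 2 := by rw [sq, ← Real.exp_add]; ring_nf
    have hy1 : 1 + x / 2 ≤ Real.exp (x / 2) := by linarith [Real.add_one_le_exp (x / 2)]
    have hex : Real.exp (-x) ≤ 1 := Real.exp_le_one_iff.2 (by linarith)
    have h4 : Real.exp (x / 2) ≤ 4 * Real.sinh x := by
      rw [Real.sinh_eq, hy]; nlinarith [Real.exp_pos (-x)]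
    have hq : 0 ≤ Real.exp (x / 2) / Real.sinh x := by positivity
    have hq' : Real.exp (x / 2) / Real.sinh x ≤ 4 := by rw [div_le_iff₀ hs]; exact h4
    have hi : 0 ≤ 1 / x := by positivity
    have hi' : 1 / x ≤ 1 := by rw [div_le_iff₀ hx]; linarith
    unfold archResidualKernel
    rw [abs_le]; constructor <;> linarith

/-- Splitting Bombieri's integrand: `(e^{x/2} a - b)/(2 sinh x) = ½(a/x - k_r(x) a - b/sinh x)`. -/
theorem bombieri_integrand_split {x : ℝ} (hx : 0 < x) (a b : ℂ) :
    ((Real.exp (x / 2) : ℂ) * a - b) / (2 * Real.sinh x : ℂ) =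
      (1 / 2 : ℂ) * (a / (x : ℂ) - (archResidualKernel x : ℂ) * a -
        b * ((1 / Real.sinh x : ℝ) : ℂ)) := by
  have hs : (Real.sinh x : ℂ) ≠ 0 := by exact_mod_cast (Real.sinh_pos_iff.2 hx).ne'
  have hx' : (x : ℂ) ≠ 0 := by exact_mod_cast hx.ne'
  unfold archResidualKernel
  push_cast
  field_simp
  ring

/-! ## The constant `∫₀¹ (1/sinh x - 1/x) dx + ∫₁^∞ dx/sinh x = log 2` -/

/-- `e^x/(e^x - 1) - e^x/(e^x + 1) = 1/sinh x` for `x ≠ 0`. -/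
theorem exp_div_sub_exp_div_eq_inv_sinh {x : ℝ} (hx : x ≠ 0) :
    Real.exp x / (Real.exp x - 1) - Real.exp x / (Real.exp x + 1) = 1 / Real.sinh x := by
  have h0 : Real.exp x - 1 ≠ 0 := sub_ne_zero.2 (by simpa using hx)
  have h1 : Real.exp x + 1 ≠ 0 := by positivity
  have h2 : Real.exp x ^ 2 - 1 ≠ 0 := by
    rw [show Real.exp x ^ 2 - 1 = (Real.exp x - 1) * (Real.exp x + 1) by ring]
    exact mul_ne_zero h0 h1
  have hsinh : Real.sinh x = (Real.exp x ^ 2 - 1) / (2 * Real.exp x) := by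
    rw [Real.sinh_eq, Real.exp_neg]; field_simp
  rw [hsinh]
  field_simp
  ring

/-- `A(x) = log(e^x - 1) - log(e^x + 1)` is a primitive of `1/sinh` on `(0, ∞)`. -/
theorem hasDerivAt_log_exp_sub_one_sub {x : ℝ} (hx : 0 < x) :
    HasDerivAt (fun y : ℝ => Real.log (Real.exp y - 1) - Real.log (Real.exp y + 1))
      (1 / Real.sinh x) x := by
  have h0 : Real.exp x - 1 ≠ 0 := by linarith [Real.one_lt_exp_iff.2 hx]
  have h1 : Real.exp x + 1 ≠ 0 := by positivity
  have := (((Real.hasDerivAt_exp x).sub_const 1).log h0).sub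
    (((Real.hasDerivAt_exp x).add_const 1).log h1)
  rwa [exp_div_sub_exp_div_eq_inv_sinh hx.ne'] at this

/-- `A(x) → 0` as `x → ∞`. -/
theorem tendsto_log_exp_sub_one_sub_atTop :
    Tendsto (fun y : ℝ => Real.log (Real.exp y - 1) - Real.log (Real.exp y + 1))
      atTop (𝓝 0) := by
  have hq : Tendsto (fun y : ℝ => (Real.exp y - 1) / (Real.exp y + 1)) atTop (𝓝 1) := by
    have h3 : Tendsto (fun y : ℝ => 1 - 2 / (Real.exp y + 1)) atTop (𝓝 (1 - 0)) :=
      tendsto_const_nhds.sub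
        ((Real.tendsto_exp_atTop.atTop_add tendsto_const_nhds).const_div_atTop 2)
    rw [sub_zero] at h3
    refine h3.congr fun y => ?_
    have : Real.exp y + 1 ≠ 0 := by positivity
    field_simp
    ring
  have hlog := hq.log one_ne_zero
  rw [Real.log_one] at hlog
  refine hlog.congr' ?_
  filter_upwards [eventually_gt_atTop (0 : ℝ)] with y hy
  rw [Real.log_div (by linarith [Real.one_lt_exp_iff.2 hy]) (by positivity)]

/-- `1/sinh` is integrable on `(1, ∞)`, with `∫₁^∞ dx/sinh x = log(e + 1) - log(e - 1)`. -/
theorem integral_inv_sinh_Ioi_one :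
    IntegrableOn (fun x : ℝ => 1 / Real.sinh x) (Ioi 1) ∧
      ∫ x in Ioi (1 : ℝ), 1 / Real.sinh x =
        Real.log (Real.exp 1 + 1) - Real.log (Real.exp 1 - 1) := by
  have hcont : ContinuousWithinAt
      (fun y : ℝ => Real.log (Real.exp y - 1) - Real.log (Real.exp y + 1)) (Ici 1) 1 :=
    (hasDerivAt_log_exp_sub_one_sub one_pos).continuousAt.continuousWithinAt
  have hderiv : ∀ x ∈ Ioi (1 : ℝ), HasDerivAt
      (fun y : ℝ => Real.log (Real.exp y - 1) - Real.log (Real.exp y + 1)) (1 / Real.sinh x) x :=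
    fun x hx => hasDerivAt_log_exp_sub_one_sub (one_pos.trans hx)
  have hpos : ∀ x ∈ Ioi (1 : ℝ), 0 ≤ 1 / Real.sinh x := fun x hx =>
    (one_div_pos.2 (Real.sinh_pos_iff.2 (one_pos.trans hx))).le
  have hint := integrableOn_Ioi_deriv_of_nonneg hcont hderiv hpos
    tendsto_log_exp_sub_one_sub_atTop
  refine ⟨hint, ?_⟩
  rw [integral_Ioi_of_hasDerivAt_of_tendsto hcont hderiv hint tendsto_log_exp_sub_one_sub_atTop]
  ring

/-- `0 < dslope exp 0 x = (e^x - 1)/x` (value `1` at `x = 0`). -/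
theorem dslope_exp_zero_pos (x : ℝ) : 0 < dslope Real.exp 0 x := by
  rcases eq_or_ne x 0 with rfl | hx
  · rw [dslope_same, Real.deriv_exp, Real.exp_zero]; exact one_pos
  · rw [dslope_of_ne _ hx, slope_def_field, Real.exp_zero, sub_zero]
    rcases lt_or_gt_of_ne hx with h | h
    · exact div_pos_of_neg_of_neg (by linarith [Real.exp_lt_one_iff.2 h]) h
    · exact div_pos (by linarith [Real.one_lt_exp_iff.2 h]) h

/-- `1/sinh x - 1/x` is integrable on `(0, 1]`, `∫₀¹ (1/sinh x - 1/x) dx = log 2 - log(e + 1) +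
log(e - 1)` (primitive `G(x) = log(e^x + 1) - log((e^x - 1)/x)` of `1/x - 1/sinh x ≥ 0`). -/
theorem integral_inv_sinh_sub_inv_Ioc :
    IntegrableOn (fun x : ℝ => 1 / Real.sinh x - 1 / x) (Ioc 0 1) ∧
      ∫ x in Ioc (0 : ℝ) 1, (1 / Real.sinh x - 1 / x) =
        Real.log 2 - Real.log (Real.exp 1 + 1) + Real.log (Real.exp 1 - 1) := by
  set G : ℝ → ℝ := fun x => Real.log (Real.exp x + 1) - Real.log (dslope Real.exp 0 x) with hG
  have hdcont : Continuous (dslope Real.exp 0) :=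
    continuousOn_univ.1 ((continuousOn_dslope (f := Real.exp) (a := (0 : ℝ)) univ_mem).2
      ⟨Real.continuous_exp.continuousOn, Real.differentiable_exp.differentiableAt⟩)
  have hGcont : Continuous G :=
    ((Real.continuous_exp.add continuous_const).log fun x =>
      (add_pos (Real.exp_pos x) one_pos).ne').sub (hdcont.log fun x => (dslope_exp_zero_pos x).ne')
  have hGderiv : ∀ x ∈ Ioo (0 : ℝ) 1, HasDerivAt G (1 / x - 1 / Real.sinh x) x := by
    intro x hx
    have hx0 : 0 < x := hx.1
    have h0 : Real.exp x - 1 ≠ 0 := by linarith [Real.one_lt_exp_iff.2 hx0]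
    have h1 : Real.exp x + 1 ≠ 0 := by positivity
    have hGeq : G =ᶠ[𝓝 x]
        fun y => Real.log (Real.exp y + 1) - (Real.log (Real.exp y - 1) - Real.log y) := by
      filter_upwards [Ioi_mem_nhds hx0] with y (hy : 0 < y)
      have hy0 : Real.exp y - 1 ≠ 0 := by linarith [Real.one_lt_exp_iff.2 hy]
      simp only [hG]
      rw [dslope_of_ne _ hy.ne', slope_def_field, Real.exp_zero, sub_zero, Real.log_div hy0 hy.ne']
    have dl : HasDerivAt (fun y : ℝ => Real.log y) (1 / x) x := by
      simpa [one_div] using Real.hasDerivAt_log hx0.ne'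
    have d := (((Real.hasDerivAt_exp x).add_const 1).log h1).sub
      ((((Real.hasDerivAt_exp x).sub_const 1).log h0).sub dl)
    have hval : Real.exp x / (Real.exp x + 1) - (Real.exp x / (Real.exp x - 1) - 1 / x) =
        1 / x - 1 / Real.sinh x := by
      rw [← exp_div_sub_exp_div_eq_inv_sinh hx0.ne']; ring
    rw [hval] at d
    exact d.congr_of_eventuallyEq hGeq
  have hpos : ∀ x ∈ Ioo (0 : ℝ) 1, 0 ≤ 1 / x - 1 / Real.sinh x := fun x hx =>
    sub_nonneg.2 (one_div_le_one_div_of_le hx.1 (Real.self_le_sinh_iff.2 hx.1.le))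
  have hint : IntegrableOn (fun x : ℝ => 1 / x - 1 / Real.sinh x) (Ioc 0 1) :=
    intervalIntegral.integrableOn_deriv_of_nonneg hGcont.continuousOn hGderiv hpos
  have hFTC : ∫ x in (0 : ℝ)..1, (1 / x - 1 / Real.sinh x) = G 1 - G 0 :=
    intervalIntegral.integral_eq_sub_of_hasDerivAt_of_le zero_le_one hGcont.continuousOn hGderiv
      ((intervalIntegrable_iff_integrableOn_Ioc_of_le zero_le_one).2 hint)
  have hG0 : G 0 = Real.log 2 := by
    simp only [hG, dslope_same, Real.deriv_exp, Real.exp_zero, Real.log_one, sub_zero]; norm_num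
  have hG1 : G 1 = Real.log (Real.exp 1 + 1) - Real.log (Real.exp 1 - 1) := by
    simp only [hG]
    rw [dslope_of_ne _ one_ne_zero, slope_def_field, Real.exp_zero, sub_zero, div_one]
  have hneg : (fun x : ℝ => 1 / Real.sinh x - 1 / x) = fun x => -(1 / x - 1 / Real.sinh x) := by
    funext x; ring
  refine ⟨by rw [hneg]; exact hint.neg, ?_⟩
  rw [hneg, integral_neg, ← intervalIntegral.integral_of_le zero_le_one, hFTC, hG0, hG1]
  ring

/-- **The constant**: `∫₀¹ (1/sinh x - 1/x) dx + ∫₁^∞ dx/sinh x = log 2`. -/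
theorem integral_inv_sinh_sub_inv_add_integral_inv_sinh :
    (∫ x in Ioc (0 : ℝ) 1, (1 / Real.sinh x - 1 / x)) + ∫ x in Ioi (1 : ℝ), 1 / Real.sinh x =
      Real.log 2 := by
  rw [integral_inv_sinh_sub_inv_Ioc.2, integral_inv_sinh_Ioi_one.2]
  ring

/-! ## Integrability of the pieces -/

/-- The singular part `(k(x) - k(0))/x` is integrable on `(0, 1]` (bounded, by the MVT). -/
theorem integrableOn_sub_div_Ioc {k : ℝ → ℂ} (hk : IsWeilTest k) :
    IntegrableOn (fun x : ℝ => (k x - k 0) / (x : ℂ)) (Ioc 0 1) := by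
  have hkc : Continuous k := hk.1.continuous
  obtain ⟨M, hM⟩ := (isCompact_Icc (a := (0 : ℝ)) (b := 1)).exists_bound_of_continuousOn
    (hk.1.continuous_deriv (by simp)).continuousOn
  have hmv : ∀ x ∈ Ioc (0 : ℝ) 1, ‖k x - k 0‖ ≤ M * x := by
    intro x hx
    have h := (convex_Icc (0 : ℝ) 1).norm_image_sub_le_of_norm_deriv_le
      (fun y _ => (hk.1.differentiable (by simp)) y) (fun y hy => hM y hy)
      (left_mem_Icc.2 zero_le_one) (Ioc_subset_Icc_self hx)
    rwa [sub_zero, Real.norm_eq_abs, abs_of_nonneg hx.1.le] at h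
  have hc : ContinuousOn (fun x : ℝ => (k x - k 0) / (x : ℂ)) (Ioc 0 1) :=
    ContinuousOn.div (by fun_prop) Complex.continuous_ofReal.continuousOn fun x hx => by
      exact_mod_cast hx.1.ne'
  have hM' : IntegrableOn (fun _ : ℝ => M) (Ioc (0 : ℝ) 1) :=
    integrableOn_const (measure_Ioc_lt_top (a := (0 : ℝ)) (b := 1)).ne
  refine Integrable.mono' hM' (hc.aestronglyMeasurable measurableSet_Ioc) ?_
  refine (ae_restrict_iff' measurableSet_Ioc).2 (Eventually.of_forall fun x hx => ?_)
  rw [norm_div, Complex.norm_real, Real.norm_of_nonneg hx.1.le, div_le_iff₀ hx.1]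
  exact hmv x hx

/-- The residual part `k_r(x) k(x)` is integrable on `(0, ∞)`. -/
theorem integrableOn_archResidualKernel_mul {k : ℝ → ℂ} (hk : IsWeilTest k) :
    IntegrableOn (fun x : ℝ => (archResidualKernel x : ℂ) * k x) (Ioi 0) := by
  have hkc : Continuous k := hk.1.continuous
  have hr : ContinuousOn archResidualKernel (Ioi 0) :=
    (continuousOn_const.div continuousOn_id fun _ hx => ne_of_gt hx).sub
      ((Real.continuous_exp.comp (continuous_id.div_const 2)).continuousOn.div
        Real.continuous_sinh.continuousOn fun _ hx => (Real.sinh_pos_iff.2 hx).ne')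
  have hc : ContinuousOn (fun x : ℝ => (archResidualKernel x : ℂ) * k x) (Ioi 0) :=
    (Complex.continuous_ofReal.comp_continuousOn hr).mul hkc.continuousOn
  refine Integrable.mono' ((hkc.integrable_of_hasCompactSupport hk.2).norm.const_mul 5).integrableOn
    (hc.aestronglyMeasurable measurableSet_Ioi) ?_
  refine (ae_restrict_iff' measurableSet_Ioi).2 (Eventually.of_forall fun x (hx : 0 < x) => ?_)
  rw [norm_mul, Complex.norm_real, Real.norm_eq_abs]
  exact mul_le_mul_of_nonneg_right (abs_archResidualKernel_le hx) (norm_nonneg _)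

/-- The tail part `k(x)/x` is integrable on `(1, ∞)`. -/
theorem integrableOn_div_Ioi {k : ℝ → ℂ} (hk : IsWeilTest k) :
    IntegrableOn (fun x : ℝ => k x / (x : ℂ)) (Ioi 1) := by
  have hkc : Continuous k := hk.1.continuous
  have hc : ContinuousOn (fun x : ℝ => k x / (x : ℂ)) (Ioi 1) :=
    hkc.continuousOn.div Complex.continuous_ofReal.continuousOn fun x hx => by
      exact_mod_cast (one_pos.trans (show (1 : ℝ) < x from hx)).ne'
  refine Integrable.mono' (hkc.integrable_of_hasCompactSupport hk.2).norm.integrableOn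
    (hc.aestronglyMeasurable measurableSet_Ioi) ?_
  refine (ae_restrict_iff' measurableSet_Ioi).2 (Eventually.of_forall fun x (hx : 1 < x) => ?_)
  rw [norm_div, Complex.norm_real, Real.norm_of_nonneg (zero_le_one.trans hx.le)]
  exact div_le_self (norm_nonneg _) hx.le

/-- Bombieri's integrand `(e^{x/2} k(x) - k(0))/(2 sinh x)` is integrable on `(0, ∞)`. -/
theorem integrableOn_bombieriIntegrand {k : ℝ → ℂ} (hk : IsWeilTest k) :
    IntegrableOn (fun x : ℝ => ((Real.exp (x / 2) : ℂ) * k x - k 0) / (2 * Real.sinh x : ℂ))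
      (Ioi 0) := by
  have hkc : Continuous k := hk.1.continuous
  have h2 : ∀ x : ℝ, 0 < x → (0 : ℝ) < 2 * Real.sinh x := fun x hx => by
    have := Real.sinh_pos_iff.2 hx; positivity
  have hc : ContinuousOn
      (fun x : ℝ => ((Real.exp (x / 2) : ℂ) * k x - k 0) / (2 * Real.sinh x : ℂ)) (Ioi 0) :=
    ContinuousOn.div
      (by fun_prop : Continuous fun x : ℝ => (Real.exp (x / 2) : ℂ) * k x - k 0).continuousOn
      (by fun_prop : Continuous fun x : ℝ => (2 * Real.sinh x : ℂ)).continuousOn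
      fun x hx => by exact_mod_cast (h2 x hx).ne'
  refine Integrable.mono' (integrableOn_bombieriMajorant hk)
    (hc.aestronglyMeasurable measurableSet_Ioi) ?_
  refine (ae_restrict_iff' measurableSet_Ioi).2 (Eventually.of_forall fun x (hx : 0 < x) => ?_)
  have hn : ‖(2 * Real.sinh x : ℂ)‖ = 2 * Real.sinh x := by
    rw [show (2 * Real.sinh x : ℂ) = ((2 * Real.sinh x : ℝ) : ℂ) by push_cast; ring,
      Complex.norm_real, Real.norm_of_nonneg (h2 x hx).le]
  rw [norm_div, hn]

/-- `∫₀^∞ = ∫₀¹ + ∫₁^∞` for a function integrable on `(0, ∞)`. -/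
theorem integral_Ioi_eq_Ioc_add_Ioi {g : ℝ → ℂ} (hg : IntegrableOn g (Ioi 0)) :
    ∫ x in Ioi (0 : ℝ), g x = (∫ x in Ioc (0 : ℝ) 1, g x) + ∫ x in Ioi (1 : ℝ), g x := by
  rw [← Ioc_union_Ioi_eq_Ioi zero_le_one, setIntegral_union Ioc_disjoint_Ioi_same measurableSet_Ioi
    (hg.mono_set Ioc_subset_Ioi_self) (hg.mono_set (Ioi_subset_Ioi zero_le_one))]

/-! ## The main identity -/

/-- **Archimedean term = ½ · logarithmic-Laplacian energy − log(2π) F(0) + ½ · bounded residual.**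
For every Weil test function `F` (`k = weilSymm F`, `k_r = archResidualKernel`):
`weilArchTermBombieri F = ½ 𝓔(F) - log(2π) F(0) + ½ ∫₀^∞ k_r(x) k(x) dx`.  PROVED. -/
theorem weilArchTermBombieri_eq_logLaplacian {F : ℝ → ℂ} (hF : IsWeilTest F) :
    weilArchTermBombieri F =
      (1 / 2 : ℂ) * logLaplacianEnergy F - (Real.log (2 * π) : ℂ) * F 0 +
        (1 / 2 : ℂ) * ∫ x in Ioi (0 : ℝ), (archResidualKernel x : ℂ) * weilSymm F x := by
  set k : ℝ → ℂ := weilSymm F with hkdef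
  have hk : IsWeilTest k := hF.weilSymm
  have hk0 : k 0 = 2 * F 0 := weilSymm_zero F
  set f : ℝ → ℂ := fun x => ((Real.exp (x / 2) : ℂ) * k x - k 0) / (2 * Real.sinh x : ℂ)
    with hfdef
  have hBdef : weilArchTermBombieri F = -((Real.log (4 * π) + Real.eulerMascheroniConstant : ℂ) *
      F 0 + ∫ x in Ioi (0 : ℝ), f x) := by
    have hI : (fun x : ℝ => ((Real.exp (x / 2) : ℂ) * (F x + F (-x)) - 2 * F 0) /
        (2 * Real.sinh x : ℂ)) = f := by
      funext x
      simp only [hfdef, hkdef, weilSymm, neg_zero]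
      ring
    unfold weilArchTermBombieri
    rw [hI]
  -- integrability of the pieces
  have hfint : IntegrableOn f (Ioi 0) := integrableOn_bombieriIntegrand hk
  have hA1 : IntegrableOn (fun x : ℝ => (k x - k 0) / (x : ℂ)) (Ioc 0 1) :=
    integrableOn_sub_div_Ioc hk
  have hA2 : IntegrableOn (fun x : ℝ => k x / (x : ℂ)) (Ioi 1) := integrableOn_div_Ioi hk
  have hB : IntegrableOn (fun x : ℝ => (archResidualKernel x : ℂ) * k x) (Ioi 0) :=
    integrableOn_archResidualKernel_mul hk
  have hB1 : IntegrableOn (fun x : ℝ => (archResidualKernel x : ℂ) * k x) (Ioc 0 1) :=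
    hB.mono_set Ioc_subset_Ioi_self
  have hB2 : IntegrableOn (fun x : ℝ => (archResidualKernel x : ℂ) * k x) (Ioi 1) :=
    hB.mono_set (Ioi_subset_Ioi zero_le_one)
  have hC1 : IntegrableOn (fun x : ℝ => k 0 * ((1 / Real.sinh x - 1 / x : ℝ) : ℂ)) (Ioc 0 1) :=
    (integral_inv_sinh_sub_inv_Ioc.1.ofReal).const_mul (k 0)
  have hC2 : IntegrableOn (fun x : ℝ => k 0 * ((1 / Real.sinh x : ℝ) : ℂ)) (Ioi 1) :=
    (integral_inv_sinh_Ioi_one.1.ofReal).const_mul (k 0)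
  -- `∫₀¹ f` and `∫₁^∞ f`, split pointwise
  have hI1 : ∫ x in Ioc (0 : ℝ) 1, f x =
      (1 / 2 : ℂ) * (-(∫ x in Ioc (0 : ℝ) 1, (k 0 - k x) / (x : ℂ)) -
        (∫ x in Ioc (0 : ℝ) 1, (archResidualKernel x : ℂ) * k x) -
        k 0 * ∫ x in Ioc (0 : ℝ) 1, ((1 / Real.sinh x - 1 / x : ℝ) : ℂ)) := by
    have h1 : ∫ x in Ioc (0 : ℝ) 1, f x = ∫ x in Ioc (0 : ℝ) 1, (1 / 2 : ℂ) *
        ((k x - k 0) / (x : ℂ) - (archResidualKernel x : ℂ) * k x -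
          k 0 * ((1 / Real.sinh x - 1 / x : ℝ) : ℂ)) :=
      setIntegral_congr_fun measurableSet_Ioc fun x hx =>
        (bombieri_integrand_split hx.1 (k x) (k 0)).trans (by push_cast; ring)
    have h2 : ∫ x in Ioc (0 : ℝ) 1, (k x - k 0) / (x : ℂ) =
        -∫ x in Ioc (0 : ℝ) 1, (k 0 - k x) / (x : ℂ) := by
      rw [← integral_neg]
      congr 1; funext x; ring
    rw [h1, integral_const_mul, integral_sub (hA1.sub' hB1) hC1, integral_sub hA1 hB1, h2,
      integral_const_mul]
  have hI2 : ∫ x in Ioi (1 : ℝ), f x =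
      (1 / 2 : ℂ) * ((∫ x in Ioi (1 : ℝ), k x / (x : ℂ)) -
        (∫ x in Ioi (1 : ℝ), (archResidualKernel x : ℂ) * k x) -
        k 0 * ∫ x in Ioi (1 : ℝ), ((1 / Real.sinh x : ℝ) : ℂ)) := by
    have h1 : ∫ x in Ioi (1 : ℝ), f x = ∫ x in Ioi (1 : ℝ), (1 / 2 : ℂ) *
        (k x / (x : ℂ) - (archResidualKernel x : ℂ) * k x - k 0 * ((1 / Real.sinh x : ℝ) : ℂ)) :=
      setIntegral_congr_fun measurableSet_Ioi fun x hx =>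
        bombieri_integrand_split (one_pos.trans hx) (k x) (k 0)
    rw [h1, integral_const_mul, integral_sub (hA2.sub' hB2) hC2, integral_sub hA2 hB2,
      integral_const_mul]
  -- the constants
  have hC : (∫ x in Ioc (0 : ℝ) 1, ((1 / Real.sinh x - 1 / x : ℝ) : ℂ)) +
      (∫ x in Ioi (1 : ℝ), ((1 / Real.sinh x : ℝ) : ℂ)) = (Real.log 2 : ℂ) := by
    rw [integral_complex_ofReal, integral_complex_ofReal, ← Complex.ofReal_add,
      integral_inv_sinh_sub_inv_add_integral_inv_sinh]
  have hlog : (Real.log (4 * π) : ℂ) = (Real.log 2 : ℂ) + (Real.log (2 * π) : ℂ) := by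
    rw [← Complex.ofReal_add, ← Real.log_mul (by norm_num) (by positivity),
      show (2 : ℝ) * (2 * π) = 4 * π by ring]
  -- assemble
  rw [hBdef, integral_Ioi_eq_Ioc_add_Ioi hfint, hI1, hI2, integral_Ioi_eq_Ioc_add_Ioi hB]
  unfold logLaplacianEnergy
  rw [← hkdef, hk0]
  linear_combination (F 0 : ℂ) * hC - (F 0 : ℂ) * hlog

end Summit.RiemannHypothesis.RiemannHypothesis.Theorems.MotivicDoor.ArchLogLaplacian
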